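import Mathlib
import Summits.KontsevichZagierPeriods.KontsevichZagierPeriods.Theorems.SoloInformedRealScaledPropagation
import Summits.KontsevichZagierPeriods.KontsevichZagierPeriods.Theorems.SoloInformedRealParamInjective
import Summits.KontsevichZagierPeriods.KontsevichZagierPeriods.Theorems.SoloInformedGenericRealParameters
import HarnessLib

/-!
# Solo-informed: THEOREM T⊗ on semi-generic scalar tuples

File B2 of the semi-generic THEOREM T⊗ route (programme note F-s224′; files A =
`SoloInformedParamScaledConst`, B1 = `SoloInformedRealScaledPropagation`).

**THEOREM T⊗, semi-generic form** (`soloInformed_realTensor_semiGeneric_prep`, conditional on the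
Lion–Rolin preparation fact only).  Let `t : Fin m → ℝ` be ALGEBRAICALLY INDEPENDENT over `ℚ` and
let `q₀, q₁, …, qₘ ∈ FormalRep ℚ`.  Then
`(q₀ ⊗ ℝ) + ∑ᵢ tᵢ • (qᵢ ⊗ ℝ) ∈ KZOver.relations ℝ  ⟹  q₀ ∈ KZOver.relations ℚ` and every
`qᵢ ∈ KZOver.relations ℚ` (`tᵢ •` = integrand scaling `soloInformedRealScale`); equivalently
(`soloInformed_realTensor_semiGeneric_iff_prep`) the map
`P_ℚ ⊗_ℤ (ℤ ⊕ ℤt₁ ⊕ ⋯ ⊕ ℤtₘ) → P_ℝ` on Kontsevich–Zagier period groups of the four-move calculus is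
INJECTIVE.  For `m = 0` this is THEOREM T (`soloInformed_baseChange_mem_relations_iff_prep`); for
one transcendental scalar see `soloInformed_realTensor_transcendental_iff_prep`.

Proof.  Write each `qᵢ ≡ [aᵢ] − [bᵢ]` (normal form over `ℚ`), so that the hypothesis element is
congruent to the scaled sum `x(1, t)` of the pair family, `x(s̃) = ∑ᵢ s̃ᵢ • ([aᵢ ⊗ ℝ] − [bᵢ ⊗ ℝ])`
(`s̃ = (s̃₀, s) ∈ ℝ^{1+m}`).  By the propagation theorem of file B1, `x(s̃)` is a relation for all
`s̃` in a `ℚ`-semialgebraic set `T ∋ (1, t)`.  Its slice `T₁ = {s | (1, s) ∈ T}` is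
`ℚ`-semialgebraic and contains the algebraically independent point `t`, hence is a NEIGHBOURHOOD
of `t` (`soloInformed_mem_nhds_of_algebraicIndependent`: a nonzero rational polynomial does not
vanish at `t`).  Moving one coordinate of `t` inside `T₁` and subtracting (increment identity,
`soloInformed_mem_relations_of_scalarCombo_pair`) gives `[aᵢ ⊗ ℝ] − [bᵢ ⊗ ℝ] ∈ relations ℝ` for
`i ≥ 1`, then for `i = 0`; THEOREM T descends to `qᵢ ∈ relations ℚ`.

References: [cite: KontsevichZagier2001, §1.2]; [cite: BochnakCosteRoy1998, Prop. 2.2.4];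
[cite: ComteLionRolin2000, Thm. 3].
-/

noncomputable section

open Set Filter Topology MvPolynomial Literature.ModelTheory.ExponentialFields
  Literature.NumberTheory.Transcendental

namespace Summit.KontsevichZagierPeriods.KontsevichZagierPeriods.Theorems

/-! ### Pair normal forms and their scaled sums -/

/-- Normal form over `ℚ`, packaged in `Σ`-types: every `q ∈ FormalRep ℚ` is congruent to a
difference of two generators. [cite: KontsevichZagier2001, §1.2] -/
theorem soloInformed_exists_sigma_pair_of_rat (q : KZOver.FormalRep ℚ) :
    ∃ a b : Σ n, KZOver.IntegralRep ℚ n,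
      q - (KZOver.of a.2 - KZOver.of b.2) ∈ KZOver.relations ℚ := by
  obtain ⟨n, n', r, r', h⟩ := soloInformed_exists_of_sub_of_rat q
  exact ⟨⟨n, r⟩, ⟨n', r'⟩, h⟩

/-- The scaled sum of the PAIR FAMILY `(aᵢ with sign +1, bᵢ with sign −1, both in slot i)` is
`∑ᵢ sᵢ • (([aᵢ] − [bᵢ]) ⊗ ℝ)`. [cite: KontsevichZagier2001, §1.2] -/
theorem soloInformed_scaledSum_pair {M : ℕ} (a b : Fin M → Σ n, KZOver.IntegralRep ℚ n)
    (s : Fin M → ℝ) :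
    soloInformedScaledSum (Sum.elim a b) (Sum.elim id id)
        (Sum.elim (fun _ => (1 : ℤ)) (fun _ => -1)) s =
      ∑ i, soloInformedRealScale (s i)
        (KZOver.baseChange ℚ ℝ (KZOver.of (a i).2 - KZOver.of (b i).2)) := by
  rw [soloInformed_scaledSum_def, Fintype.sum_sum_type]
  simp only [Sum.elim_inl, Sum.elim_inr, id_eq, one_zsmul, neg_one_zsmul, map_sub,
    KZOver.baseChange_of, soloInformed_realScale_of, Finset.sum_neg_distrib,
    Finset.sum_sub_distrib]
  rw [sub_eq_add_neg]

/-! ### Slices and one-coordinate perturbations -/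

/-- **Slicing at first coordinate `1`** keeps `ℚ`-semialgebraicity:
`{s | (1, s) ∈ T}` is the projection of `T ∩ {w₀ = 1}`. [cite: BochnakCosteRoy1998, Thm. 2.2.1] -/
theorem soloInformed_isSemialgebraic_slice_cons_one {m : ℕ} {T : Set (Fin (m + 1) → ℝ)}
    (hT : IsSemialgebraic ℚ T) :
    IsSemialgebraic ℚ {s : Fin m → ℝ | (Fin.cons 1 s : Fin (m + 1) → ℝ) ∈ T} := by
  have hH : IsSemialgebraic ℚ {w : Fin (m + 1) → ℝ | w 0 = 1} := by
    have hset : {w : Fin (m + 1) → ℝ | w 0 = 1} =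
        {w | aeval w (X 0 - C 1 : MvPolynomial (Fin (m + 1)) ℚ) = 0} := by
      ext w
      simp [sub_eq_zero]
    rw [hset]
    exact isSemialgebraic_setOf_eval_eq_zero _
  have hset : {s : Fin m → ℝ | (Fin.cons 1 s : Fin (m + 1) → ℝ) ∈ T} =
      (fun w : Fin (m + 1) → ℝ => w ∘ Fin.succ) '' (T ∩ {w | w 0 = 1}) := by
    ext s
    simp only [mem_setOf_eq, mem_image, mem_inter_iff]
    constructor
    · intro hs
      refine ⟨Fin.cons 1 s, ⟨hs, by simp⟩, ?_⟩
      funext i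
      simp
    · rintro ⟨w, ⟨hwT, hw0⟩, rfl⟩
      have hw : (Fin.cons 1 (w ∘ Fin.succ) : Fin (m + 1) → ℝ) = w := by
        rw [← hw0]
        exact Fin.cons_self_tail w
      rw [hw]
      exact hwT
  rw [hset]
  exact (hT.inter hH).image_comp_of_finite Fin.succ

/-- **One-coordinate perturbation inside a neighbourhood**: a neighbourhood of `t` contains a point
differing from `t` exactly in the (prescribed) coordinate `i`, by a nonzero amount.
[cite: BochnakCosteRoy1998, Prop. 2.2.4] -/
theorem soloInformed_exists_update_mem_of_mem_nhds {m : ℕ} {t : Fin m → ℝ} {U : Set (Fin m → ℝ)}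
    (hU : U ∈ 𝓝 t) (i : Fin m) : ∃ ε : ℝ, ε ≠ 0 ∧ Function.update t i (t i + ε) ∈ U := by
  have hc : Continuous fun ε : ℝ => Function.update t i (t i + ε) := by
    refine continuous_pi fun j => ?_
    by_cases hj : j = i
    · subst hj
      simp only [Function.update_self]
      exact continuous_const.add continuous_id
    · simp only [Function.update_of_ne hj]
      exact continuous_const
  have h0 : Function.update t i (t i + 0) = t := by rw [add_zero, Function.update_eq_self]
  have hpre : (fun ε : ℝ => Function.update t i (t i + ε)) ⁻¹' U ∈ 𝓝 (0 : ℝ) := by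
    refine hc.continuousAt.preimage_mem_nhds ?_
    show U ∈ 𝓝 (Function.update t i (t i + 0))
    rw [h0]
    exact hU
  obtain ⟨δ, hδ, hball⟩ := Metric.mem_nhds_iff.1 hpre
  refine ⟨δ / 2, (half_pos hδ).ne', hball ?_⟩
  rw [Metric.mem_ball, Real.dist_eq, sub_zero, abs_of_pos (half_pos hδ)]
  exact half_lt_self hδ

/-! ### THEOREM T⊗ on semi-generic scalar tuples -/

/-- **THEOREM T⊗, semi-generic scalars** (conditional on the preparation fact).  For `t`
algebraically independent over `ℚ` and `ℚ`-data `q₀, qᵢ`: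
`(q₀ ⊗ ℝ) + ∑ᵢ tᵢ • (qᵢ ⊗ ℝ) ∈ relations ℝ` forces `q₀ ∈ relations ℚ` and all `qᵢ ∈ relations ℚ`.
[cite: KontsevichZagier2001, §1.2] -/
theorem soloInformed_realTensor_semiGeneric_prep (hprep : semialgebraicPreparation) {m : ℕ}
    {t : Fin m → ℝ} (ht : AlgebraicIndependent ℚ t) (q₀ : KZOver.FormalRep ℚ)
    (q : Fin m → KZOver.FormalRep ℚ)
    (h : KZOver.baseChange ℚ ℝ q₀ + ∑ i, soloInformedRealScale (t i) (KZOver.baseChange ℚ ℝ (q i)) ∈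
      KZOver.relations ℝ) :
    q₀ ∈ KZOver.relations ℚ ∧ ∀ i, q i ∈ KZOver.relations ℚ := by
  classical
  -- the `m + 1` pieces of `ℚ`-data, slot `0` carrying `q₀` (scalar `1`)
  let qq : Fin (m + 1) → KZOver.FormalRep ℚ := Fin.cons q₀ q
  have hqq0 : qq 0 = q₀ := Fin.cons_zero _ _
  have hqqs : ∀ i : Fin m, qq i.succ = q i := fun i => Fin.cons_succ _ _ i
  choose a b hab using fun i => soloInformed_exists_sigma_pair_of_rat (qq i)
  -- `X i = ([a i] − [b i]) ⊗ ℝ ≡ qq i ⊗ ℝ`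
  let X : Fin (m + 1) → KZOver.FormalRep ℝ := fun i =>
    KZOver.baseChange ℚ ℝ (KZOver.of (a i).2 - KZOver.of (b i).2)
  have hX : ∀ i, KZOver.baseChange ℚ ℝ (qq i) - X i ∈ KZOver.relations ℝ := fun i => by
    have h₁ := KZOver.baseChange_mem_relations ℝ (hab i)
    rwa [map_sub] at h₁
  have hsum : ∀ s : Fin (m + 1) → ℝ,
      soloInformedScaledSum (Sum.elim a b) (Sum.elim id id)
        (Sum.elim (fun _ => (1 : ℤ)) (fun _ => -1)) s = ∑ i, soloInformedRealScale (s i) (X i) :=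
    fun s => soloInformed_scaledSum_pair a b s
  have hcongr : ∀ s : Fin (m + 1) → ℝ,
      (∑ i, soloInformedRealScale (s i) (X i)) -
        ∑ i, soloInformedRealScale (s i) (KZOver.baseChange ℚ ℝ (qq i)) ∈ KZOver.relations ℝ := by
    intro s
    rw [← Finset.sum_sub_distrib]
    refine sum_mem fun i _ => ?_
    rw [← map_sub]
    refine soloInformed_realScale_mem_relations (s i) ?_
    have h₁ := neg_mem (hX i)
    rwa [neg_sub] at h₁
  -- at `s̃₀ = (1, t)` the scaled sum is congruent to the hypothesis element
  let s₀ : Fin (m + 1) → ℝ := Fin.cons 1 t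
  have hs₀ : ∑ i, soloInformedRealScale (s₀ i) (KZOver.baseChange ℚ ℝ (qq i)) =
      KZOver.baseChange ℚ ℝ q₀ +
        ∑ i, soloInformedRealScale (t i) (KZOver.baseChange ℚ ℝ (q i)) := by
    rw [Fin.sum_univ_succ]
    simp only [s₀, qq, Fin.cons_zero, Fin.cons_succ, soloInformed_realScale_one]
  have hrel₀ : soloInformedScaledSum (Sum.elim a b) (Sum.elim id id)
      (Sum.elim (fun _ => (1 : ℤ)) (fun _ => -1)) s₀ ∈ KZOver.relations ℝ := by
    rw [hsum]
    have h₁ : ∑ i, soloInformedRealScale (s₀ i) (KZOver.baseChange ℚ ℝ (qq i)) ∈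
        KZOver.relations ℝ := by
      rw [hs₀]
      exact h
    have h₂ := add_mem (hcongr s₀) h₁
    rwa [sub_add_cancel] at h₂
  -- file B1: the scaled sum stays a relation on a `ℚ`-semialgebraic set of scalar vectors
  obtain ⟨T, hT, hs₀T, hTrel⟩ := soloInformed_scaledSum_propagation_prep hprep _ _ _ hrel₀
  -- slice at first coordinate `1`: a neighbourhood of the algebraically independent point `t`
  let T₁ : Set (Fin m → ℝ) := {s | (Fin.cons 1 s : Fin (m + 1) → ℝ) ∈ T}
  have hT₁ : IsSemialgebraic ℚ T₁ := soloInformed_isSemialgebraic_slice_cons_one hT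
  have htT₁ : t ∈ T₁ := hs₀T
  have hnhds : T₁ ∈ 𝓝 t := soloInformed_mem_nhds_of_algebraicIndependent ht hT₁ htT₁
  -- on the slice the scaled sum is the scalar combination `(1 • X 0) + ∑ᵢ sᵢ • X (i+1)`
  have hcombo : ∀ s ∈ T₁, soloInformedScalarCombo (soloInformedRealScale 1 (X 0))
      (fun i => X i.succ) s ∈ KZOver.relations ℝ := by
    intro s hs
    have h₁ := hTrel _ hs
    rw [hsum, Fin.sum_univ_succ] at h₁
    simpa only [soloInformed_scalarCombo_def, Fin.cons_zero, Fin.cons_succ] using h₁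
  -- increment identity: each `X (i+1)` is a relation, then `X 0`
  have hXsucc : ∀ i : Fin m, X i.succ ∈ KZOver.relations ℝ := by
    intro i
    obtain ⟨ε, hε, hmem⟩ := soloInformed_exists_update_mem_of_mem_nhds hnhds i
    refine soloInformed_mem_relations_of_scalarCombo_pair (soloInformedRealScale 1 (X 0))
      (fun i => X i.succ) (s := t) (s' := Function.update t i (t i + ε)) (i := i)
      (fun j hj => Function.update_of_ne hj _ _) ?_ (hcombo t htT₁) (hcombo _ hmem)
    rw [Function.update_self]
    simpa using hε
  have hX0 : X 0 ∈ KZOver.relations ℝ := by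
    have h₁ := soloInformed_base_mem_relations_of_scalarCombo _ _ t (hcombo t htT₁) hXsucc
    rwa [soloInformed_realScale_one] at h₁
  have hXall : ∀ i, X i ∈ KZOver.relations ℝ := fun i => by
    rcases Fin.eq_zero_or_eq_succ i with rfl | ⟨j, rfl⟩
    · exact hX0
    · exact hXsucc j
  -- descend to `ℚ` by THEOREM T
  have hqq : ∀ i, qq i ∈ KZOver.relations ℚ := fun i => by
    have h₁ := add_mem (hX i) (hXall i)
    rw [sub_add_cancel] at h₁
    exact (soloInformed_baseChange_mem_relations_iff_prep hprep (qq i)).1 h₁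
  refine ⟨?_, fun i => ?_⟩
  · rw [← hqq0]
    exact hqq 0
  · rw [← hqqs i]
    exact hqq i.succ

/-- **THEOREM T⊗, semi-generic scalars, `iff` form**: for `t` algebraically independent over `ℚ`,
`(q₀ ⊗ ℝ) + ∑ᵢ tᵢ • (qᵢ ⊗ ℝ) ∈ relations ℝ ↔ q₀ ∈ relations ℚ ∧ ∀ i, qᵢ ∈ relations ℚ`, i.e.
`P_ℚ ⊗ (ℤ ⊕ ⨁ᵢ ℤ tᵢ) → P_ℝ` is injective. [cite: KontsevichZagier2001, §1.2] -/
theorem soloInformed_realTensor_semiGeneric_iff_prep (hprep : semialgebraicPreparation) {m : ℕ}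
    {t : Fin m → ℝ} (ht : AlgebraicIndependent ℚ t) (q₀ : KZOver.FormalRep ℚ)
    (q : Fin m → KZOver.FormalRep ℚ) :
    KZOver.baseChange ℚ ℝ q₀ + ∑ i, soloInformedRealScale (t i) (KZOver.baseChange ℚ ℝ (q i)) ∈
        KZOver.relations ℝ ↔
      q₀ ∈ KZOver.relations ℚ ∧ ∀ i, q i ∈ KZOver.relations ℚ :=
  ⟨soloInformed_realTensor_semiGeneric_prep hprep ht q₀ q, fun h =>
    add_mem (KZOver.baseChange_mem_relations ℝ h.1)
      (sum_mem fun i _ =>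
        soloInformed_realScale_mem_relations (t i) (KZOver.baseChange_mem_relations ℝ (h.2 i)))⟩

/-- The same in the `soloInformedScalarCombo` notation of file A. [cite: KontsevichZagier2001, §1.2] -/
theorem soloInformed_scalarCombo_baseChange_mem_relations_iff_prep
    (hprep : semialgebraicPreparation) {m : ℕ} {t : Fin m → ℝ} (ht : AlgebraicIndependent ℚ t)
    (q₀ : KZOver.FormalRep ℚ) (q : Fin m → KZOver.FormalRep ℚ) :
    soloInformedScalarCombo (KZOver.baseChange ℚ ℝ q₀) (fun i => KZOver.baseChange ℚ ℝ (q i)) t ∈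
        KZOver.relations ℝ ↔
      q₀ ∈ KZOver.relations ℚ ∧ ∀ i, q i ∈ KZOver.relations ℚ := by
  rw [soloInformed_scalarCombo_baseChange]
  exact soloInformed_realTensor_semiGeneric_iff_prep hprep ht q₀ q

/-- **One transcendental scalar** (`m = 1`): for `τ` transcendental over `ℚ`,
`(q₀ ⊗ ℝ) + τ • (q₁ ⊗ ℝ) ∈ relations ℝ ↔ q₀ ∈ relations ℚ ∧ q₁ ∈ relations ℚ` — the map
`P_ℚ ⊗ (ℤ ⊕ ℤτ) → P_ℝ` is injective. [cite: KontsevichZagier2001, §1.2] -/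
theorem soloInformed_realTensor_transcendental_iff_prep (hprep : semialgebraicPreparation) {τ : ℝ}
    (hτ : Transcendental ℚ τ) (q₀ q₁ : KZOver.FormalRep ℚ) :
    KZOver.baseChange ℚ ℝ q₀ + soloInformedRealScale τ (KZOver.baseChange ℚ ℝ q₁) ∈
        KZOver.relations ℝ ↔
      q₀ ∈ KZOver.relations ℚ ∧ q₁ ∈ KZOver.relations ℚ := by
  have ht : AlgebraicIndependent ℚ (fun _ : Fin 1 => τ) :=
    algebraicIndependent_unique_type_iff.mpr hτ
  have h := soloInformed_realTensor_semiGeneric_iff_prep hprep ht q₀ (fun _ => q₁)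
  rw [Fin.sum_univ_one] at h
  exact h.trans ⟨fun h' => ⟨h'.1, h'.2 0⟩, fun h' => ⟨h'.1, fun _ => h'.2⟩⟩

/-- **Difference form** (generalising `soloInformed_realParameterTransfer_prep` to several generic
scalars): a `KZ_ℝ`-relation between two semi-generic elements with the same algebraically
independent scalars forces coefficientwise `KZ_ℚ`-congruence. [cite: KontsevichZagier2001, §1.2] -/
theorem soloInformed_realTensor_semiGeneric_sub_prep (hprep : semialgebraicPreparation) {m : ℕ}
    {t : Fin m → ℝ} (ht : AlgebraicIndependent ℚ t) (q₀ q₀' : KZOver.FormalRep ℚ)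
    (q q' : Fin m → KZOver.FormalRep ℚ)
    (h : (KZOver.baseChange ℚ ℝ q₀ + ∑ i, soloInformedRealScale (t i) (KZOver.baseChange ℚ ℝ (q i))) -
        (KZOver.baseChange ℚ ℝ q₀' +
          ∑ i, soloInformedRealScale (t i) (KZOver.baseChange ℚ ℝ (q' i))) ∈ KZOver.relations ℝ) :
    q₀ - q₀' ∈ KZOver.relations ℚ ∧ ∀ i, q i - q' i ∈ KZOver.relations ℚ := by
  refine soloInformed_realTensor_semiGeneric_prep hprep ht (q₀ - q₀') (fun i => q i - q' i) ?_
  have heq : KZOver.baseChange ℚ ℝ (q₀ - q₀') +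
      ∑ i, soloInformedRealScale (t i) (KZOver.baseChange ℚ ℝ (q i - q' i)) =
      (KZOver.baseChange ℚ ℝ q₀ + ∑ i, soloInformedRealScale (t i) (KZOver.baseChange ℚ ℝ (q i))) -
        (KZOver.baseChange ℚ ℝ q₀' +
          ∑ i, soloInformedRealScale (t i) (KZOver.baseChange ℚ ℝ (q' i))) := by
    simp only [map_sub, Finset.sum_sub_distrib]
    abel
  rw [heq]
  exact h

end Summit.KontsevichZagierPeriods.KontsevichZagierPeriods.Theorems
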